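import Literature.Probability.LatticeModels.HardCoreUrsell
import Literature.Combinatorics.Enumerative.CayleyForests
import Literature.MathematicalPhysics.QuantumFieldTheory.Dimock2011to13.UrsellConnectedGraphSum
import Literature.Combinatorics.Enumerative.CayleyDegreeFormula

/-!
# Dimock, *The renormalization group according to Balaban* I, Appendix B, proof of THEOREM `\label{cluster}`, STEP 4 —
# THE TREE-GRAPH INEQUALITY *"|ρ^T(Y_1, …, Y_n)| ≤ number of tree graphs contained in g"* — PROVED (for every finite
# symmetric graph), together with (sunset), *"ρ^T = 0 if the Y_j can be divided into disjoint sets"*, and the Cayley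
# majorant `n^{n−2}`

**Citation header (reproduction of PUBLISHED work; template of the Bałaban lattice Yang–Mills cell).**
J. Dimock, *The renormalization group according to Balaban I. Small fields*, Rev. Math. Phys. **25** (2013) 1330010
(= arXiv:1108.1335v2) [Dimock2013], Appendix B "cluster expansion", proof of THEOREM `\label{cluster}` (#27): step 3
TeX L3316–3354 (the hard core `ζ`, eq. (sunset) L3341–3346, the Ursell coefficients `ρ^T` L3347–3354) and step 4
L3405–3421 (the overlap graph `g` of a tuple, the tree-graph inequality), L3449–3450 (tree graphs as self-maps).  TeX line
numbers refer to the arXiv source held by the cell (`inputs/files/dimock/src/1108.1335/1108.1335.tex`); every quotation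
below was read there this session.  Dimock's papers are published and refereed and are the cell's TEMPLATE, not
manuscripts under audit; no quantity of the Bałaban series is touched.  Dimock's general references for App. B (L3163):
*"[Cam82], [Sei82], [Bry86], [GlJa87]"* ([Bry86] = [Brydges1986]).

**What the paper prints (verbatim).**  L3322–3324: *"let ζ(X,Y) = 1 if X ∩ Y = ∅ and ζ(X,Y) = 0 if X ∩ Y ≠ ∅"*.
(sunset), L3341–3354: *"Π_{{i,j}} ζ(Y_i, Y_j) = Σ_{K=1}^n Σ_{{I_1,…,I_K} ∈ π_{n,K}} Π_{k=1}^K ρ^T(Y_{I_k}) where π_{n,K} is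
the partitions of (1,…,n) into K subsets. We have defined ρ^T(Y) = 1 and for n ≥ 2 ρ^T(Y_1,…,Y_n) = Σ_G Π_{{i,j}∈G}
(ζ(Y_i,Y_j) − 1) where the sum is now over connected graphs G on (1,…,n). We do have ρ^T(Y_1,…,Y_n) = 0 if the Y_j can
be divided into disjoint sets."*  Step 4, L3408–3421: *"Each indivisible n-tuple (Y_1,…,Y_n) determines a connected graph
g on (1,…,n): a pair {i,j} ∈ g if Y_i ∩ Y_j ≠ ∅. We write (Y_1,…,Y_n) → g The expression ρ^T(Y_1,…,Y_n) only depends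
on the graph (it is a certain sum over subgraphs) and one can show that |ρ^T(Y_1,…,Y_n)| ≤ number of tree graphs
contained in g"*; L3449–3450: *"After relabeling a tree graph τ can be thought of as a map τ from (1,…,n) to itself
such that τ(j) < j. The restrictions in the sum over (Y_1,…,Y_n) are then that Y_j ∩ Y_{τ(j)} ≠ ∅."*

**What is reproduced here (kernel-checked, zero `sorry`).**  The *"one can show"* of step 4, PROVED for every finite
vertex set `V` and every symmetric graph `H` on it, on top of two tree modules: `Literature.Probability.LatticeModels.HardCoreUrsell`
(the hard-core Ursell coefficient `hcUrsell H V`, DEFINED by Möbius inversion from the identity `Σ_{π set partition}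
Π_{P∈π} u(P) = 𝟙[V spans no edge]` — which is exactly (sunset) — and its ROOTED RECURSION `hcUrsell_eq_hcRootedUrsell`:
`u(V) = Σ_{ρ ∈ setPartitions(V∖v)} (−1)^{#ρ} Π_{Q∈ρ} 𝟙[Q ∼ v]·u(Q)`) and `Literature.Combinatorics.Enumerative.CayleyForests`
(rooted forests as PARENT MAPS `IsForestOn S R t`, Cayley's formula).
* §1–§2 TREE GRAPHS AS PARENT MAPS (Dimock L3449: *"a map τ from (1,…,n) to itself"*): `treeGraphs H V v` = the rooted
  forests on `V` with the single root `v` (`CayleyForests.forests V {v}`) every edge `u → t u` of which lies in `H` — the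
  spanning trees of `H` on `V`, oriented towards `v`; the root is the unique fixed vertex (`apply_eq_self_iff`), first
  hitting times (`exists_first_hit`); `blockTrees H v Q` = trees on a block `Q` rooted at a vertex adjacent to `v`.
* §3 GLUING (`glue`): block trees on the blocks of a set partition of `V ∖ {v}`, each rooted at a neighbour of `v`, glue to
  a tree on `V` rooted at `v` (`glue_mem_treeGraphs`; the glued walk follows the block tree to its root and then jumps
  to `v`: `glue_iterate_hit`, `glue_iterate_mem`).
* §4 INJECTIVITY: the glued tree determines the blocks (`eq_of_glue_eq`: the block of `w` is the set of vertices whose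
  walk passes through the same neighbour of `v`) and the block trees (`apply_eq_of_glue_eq`).
* §5 **THE TREE-GRAPH INEQUALITY** `abs_hcUrsell_le_card_treeGraphs`: `|u_H(V)| ≤ #treeGraphs H V v` for symmetric `H`
  and `v ∈ V` — by strong induction on `V` through the rooted recursion: `|u(V)| ≤ Σ_ρ Π_{Q∈ρ} 𝟙[Q ∼ v]|u(Q)| ≤ Σ_ρ Π_Q
  #blockTrees(Q) = #recData ≤ #treeGraphs(V)` (`card_recData`, `glueData_injOn`, `Finset.card_le_card_of_injOn`); and
  the Cayley majorant `card_treeGraphs_le_pow` (`#treeGraphs ≤ |V|^{|V|−2}`, from `CayleyForests.card_forests_mul_card`),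
  `abs_hcUrsell_le_pow`.
* §6 NO TREE CROSSES A SPLIT: `treeGraphs_eq_empty_of_split` (two parts of `V` with no edge between them carry no tree).
* §7 DIMOCK'S FORM: indices `ι` of a tuple `Y : ι → Finset C` of cube sets, `overlapGraph Y` (= `g`), **`rhoT Y I :=
  hcUrsell (overlapGraph Y) I`**, **`sunset`** (the printed (sunset): `Σ_{π} Π_{P∈π} ρ^T(Y_P) = Π ζ = 𝟙[pairwise disjoint]`),
  `rhoT_singleton` (`ρ^T(Y) = 1`), **`abs_rhoT_le_card_treeGraphs`** (THE PRINTED INEQUALITY), `abs_rhoT_le_pow`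
  (`≤ n^{n−2}`), **`rhoT_eq_zero_of_split`** (*"ρ^T = 0 if the Y_j can be divided into disjoint sets"*).
* §9 (v1.2) STEP 4's CAYLEY INPUT (spit2) (L3487–3500: *"By Cayley's theorem the number of trees with incidence numbers d_j is
  (n−2)!/Π_{j=1}^n (d_j−1)! so we have Σ_τ Π_{j=1}^n (d_j−1)! … ≤ Σ_{d_1,…,d_n}(n−2)! ≤ (n−2)! 4^{n−1}"*): **`sum_treeGraphs_prod_factorial_le`**
  — for every graph `H`, `|V| ≥ 2`, `v ∈ V`: `Σ_{τ ∈ treeGraphs H V v} Π_{u∈V} (d_u(τ) − 1)! ≤ (|V|−2)!·4^{|V|−1}`, the incidence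
  numbers `d_u(τ) = #children + [u ≠ v]` (`CayleyDegreeFormula.degree`), from the tree's CAYLEY FORMULA WITH PRESCRIBED DEGREES
  (`Literature.Combinatorics.Enumerative.CayleyDegreeFormula`, [Rivasseau1991] Thm I.4.1, this lineage gen 33: the sum over ALL
  trees equals `(n−2)!·#{realised degree vectors} ≤ (n−2)!·4^{n−1}`) by monotonicity (`treeGraphs ⊆ forests V {v}`); Dimock's instance
  `sum_treeGraphs_overlap_prod_factorial_le` for `g = overlapGraph Y`.
* §8 (v1.1) READING (ii) DISCHARGED: **`rhoT_eq_sum_graphs`** — `ρ^T` (the solution of (sunset)) EQUALS the printed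
  definition *"Σ_G Π_{{i,j}∈G}(ζ(Y_i,Y_j) − 1) where the sum is now over connected graphs G on (1,…,n)"* (L3347–3352), by
  the sibling leaf `UrsellConnectedGraphSum` (`hcUrsell_overlap_eq_sum_graphs`, unit gen 32, now imported); and
  `rhoT_eq_connSum` (the reduced form: the sum over the connected spanning edge sets INSIDE `g` of `(−1)^{|G|}`).

**Readings (declared).**  (i) TREE GRAPHS are recorded as parent maps towards a root `v ∈ V` (a spanning tree of `g`
oriented to `v`; orientation towards a fixed root is a bijection between spanning trees and such maps — the standard fact
behind Dimock's own L3449 *"τ can be thought of as a map"*; his additional relabeling `τ(j) < j` is not reproduced).  (ii)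
`ρ^T` is taken as THE UNIQUE SOLUTION OF (sunset), i.e. the tree's Möbius-defined `hcUrsell` for the overlap graph — (sunset)
determines `ρ^T(Y_I)` by induction on `|I|` (the partition `{I}` isolates it); the connected-graph formula L3349–3352 is the
print's definition and (sunset) its theorem, here the other way round (as in `HardCoreUrsell`, whose header says the same);
the equality of the two is the sibling leaf `UrsellConnectedGraphSum` (gen 32), imported from v1.1 on: §8 `rhoT_eq_sum_graphs`.  (iii) The inequality is proved for an arbitrary symmetric relation `H` on
any finite vertex type (self-loops `H u u` play no role: compatibility compares distinct vertices and a tree edge `u → t u`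
has `t u ≠ u` off the root); Dimock's `g` is the instance `H = overlapGraph Y` on the index set.  (iv) The majorant
`n^{n−2}` (Cayley) is the classical corollary, not printed by Dimock (he counts trees with their incidence numbers via
Cayley's theorem in (spit2), L3483–3497 — not reproduced).

**What is NOT claimed.**  The rest of step 4 (the summation over tuples compatible with a tree, (sudsy), the incidence-number
bookkeeping `|Y_j|^{d_j−1} ≤ (d_j−1)! e^{|Y_j|}`, (spit1), the bound on `H^#` and (sunshine0) — (spit2) and its Cayley input
are §9 from v1.2 on); the identification of `degree` with the graph-theoretic degree of the unoriented tree (it is the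
definition: children plus the parent edge); anything about `d_M`; anything of B1–B16
(TEMPLATE.md §4.1 row «D1 §4.6» ↔ B12∕B13 cluster expansions — grade there; untouched).  NOT summit progress; NOT a statement
about any Bałaban paper; NOT continuum; NOT Clay.  Imports `Literature.Probability.LatticeModels.HardCoreUrsell`,
`Literature.Combinatorics.Enumerative.CayleyForests` (both Mathlib-only leaves of the tree) and (v1.1) the sibling
`…Dimock2011to13.UrsellConnectedGraphSum` (which imports `…MayerExpansion` and `HardCoreUrsell`; it does not import this
file — no cycle; no Summits import) and (v1.2) `Literature.Combinatorics.Enumerative.CayleyDegreeFormula` (this lineage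
gen 33, p207972; imports `CayleyForests` + `AntidiagonalTupleCard`); sub-namespace `…Dimock2011to13.UrsellTreeGraphBound`;
modifies nothing.  Unit
`b2b-balaban-template` gen 32 (journal CLAIM D1-TREE-GRAPH-KERNEL); cell records TEMPLATE.md §4.1 row «D1 §4.6», §15.2; GAPS
C-tmpl32-7.

**Version.**  v1.1 (unit `b2b-balaban-template` gen 33, journal CLAIM D1-RHOT-GRAPH-SUM-KERNEL) — ADDITIVE to v1 (p206758,
commit 51d203286d5d): + import `…UrsellConnectedGraphSum`; + §8 (`rhoT_eq_connSum`, `rhoT_eq_sum_graphs`); header reading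
(ii) and the NOT-claimed list updated accordingly; every v1 declaration byte-identical.  v1.2 (same unit and gen, journal CLAIM
D1-SPIT2-KERNEL) — ADDITIVE to v1.1: + import `…CayleyDegreeFormula`; + §9 (`sum_treeGraphs_prod_factorial_le`,
`sum_treeGraphs_overlap_prod_factorial_le`); header bullets ∕ NOT-claimed list updated; every v1.1 declaration byte-identical.
-/

noncomputable section

open Finset Function
open Literature.Probability.LatticeModels (IsSetPartition setPartitions mem_setPartitions blockOf hcUrsell
  hcRootedUrsell adjInd hcUrsell_eq_hcRootedUrsell IsCompatible edgeFreeInd sum_setPartitions_prod_hcUrsell)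
open Literature.Combinatorics.Enumerative (IsForestOn forests mem_forests card_forests_mul_card)

namespace Literature.MathematicalPhysics.QuantumFieldTheory.Dimock2011to13.UrsellTreeGraphBound

variable {α : Type*} [DecidableEq α]

/-! ## §1 Rooted trees as parent maps: the root is the unique fixed vertex, first hitting times -/

section Paths

variable {Q : Finset α} {r u : α} {t : α → α}

/-- in a tree on `Q` rooted at `r ∈ Q` (parent map), the root is the only vertex fixed by the parent map. [cite: Dimock2013, App. B Theorem cluster, proof step 4 (arXiv:1108.1335v2 TeX L3405–3421, L3449–3450)] -/
theorem apply_eq_self_iff (ht : IsForestOn Q {r} t) (hu : u ∈ Q) : t u = u ↔ u = r := by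
  constructor
  · intro hfix
    obtain ⟨n, hn⟩ := ht.2 u hu
    rw [Function.iterate_fixed hfix n, Finset.mem_singleton] at hn
    exact hn
  · rintro rfl
    exact ht.apply_of_mem_roots (Finset.mem_singleton_self _)

/-- first hitting time of the root: the walk from `u ∈ Q` reaches `r` at a time `n` before which it stays in `Q ∖ {r}`. [cite: Dimock2013, App. B Theorem cluster, proof step 4 (arXiv:1108.1335v2 TeX L3405–3421, L3449–3450)] -/
theorem exists_first_hit (ht : IsForestOn Q {r} t) (hr : r ∈ Q) (hu : u ∈ Q) :
    ∃ n, t^[n] u = r ∧ ∀ m < n, t^[m] u ∈ Q ∧ t^[m] u ≠ r := by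
  classical
  have hex : ∃ n, t^[n] u = r := by
    obtain ⟨n, hn⟩ := ht.2 u hu
    exact ⟨n, Finset.mem_singleton.1 hn⟩
  refine ⟨Nat.find hex, Nat.find_spec hex, fun m hm => ⟨?_, Nat.find_min hex hm⟩⟩
  exact ht.iterate_mem (Finset.singleton_subset_iff.2 hr) hu m

omit [DecidableEq α] in
/-- two self-maps that agree on a set containing the first `n` points of a walk have the same walk up to time `n`. [cite: Dimock2013, App. B Theorem cluster, proof step 4 (arXiv:1108.1335v2 TeX L3405–3421, L3449–3450)] -/
theorem iterate_eq_of_agree {t t' : α → α} {u : α} {n : ℕ} (hmem : ∀ m < n, t' (t^[m] u) = t (t^[m] u)) :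
    ∀ m ≤ n, t'^[m] u = t^[m] u := by
  intro m hm
  induction m with
  | zero => simp
  | succ m ih =>
    rw [Function.iterate_succ_apply', Function.iterate_succ_apply', ih (Nat.le_of_succ_le hm)]
    exact hmem m (Nat.lt_of_succ_le hm)

end Paths

/-! ## §2 Tree graphs on a vertex set contained in a graph `H`, as parent maps towards a root -/

section TreeGraphs

variable (H : α → α → Prop) [DecidableRel H] [Fintype α]

/-- the TREE GRAPHS on the vertex set `V` contained in the graph `H`, recorded as parent maps towards the root `v`. [cite: Dimock2013, App. B Theorem cluster, proof step 4 (arXiv:1108.1335v2 TeX L3405–3421, L3449–3450)] -/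
def treeGraphs (V : Finset α) (v : α) : Finset (α → α) :=
  (forests V {v}).filter fun t => ∀ u ∈ V.erase v, H u (t u)

variable {H}

/-- membership in `treeGraphs`. [cite: Dimock2013, App. B Theorem cluster, proof step 4 (arXiv:1108.1335v2 TeX L3405–3421, L3449–3450)] -/
theorem mem_treeGraphs {V : Finset α} {v : α} {t : α → α} :
    t ∈ treeGraphs H V v ↔ IsForestOn V {v} t ∧ ∀ u ∈ V.erase v, H u (t u) := by
  simp [treeGraphs]

/-- tree graphs are rooted forests with the single root `v`. [cite: Dimock2013, App. B Theorem cluster, proof step 4 (arXiv:1108.1335v2 TeX L3405–3421, L3449–3450)] -/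
theorem treeGraphs_subset_forests (V : Finset α) (v : α) : treeGraphs H V v ⊆ forests V {v} :=
  Finset.filter_subset _ _

variable (H)

/-- the trees on a block `Q` rooted at a vertex ADJACENT TO `v` (the data attached to one block in the rooted recursion). [cite: Dimock2013, App. B Theorem cluster, proof step 4 (arXiv:1108.1335v2 TeX L3405–3421, L3449–3450)] -/
def blockTrees (v : α) (Q : Finset α) : Finset (α → α) :=
  (Q.filter fun r => H v r).biUnion fun r => treeGraphs H Q r

variable {H}

/-- membership in `blockTrees`. [cite: Dimock2013, App. B Theorem cluster, proof step 4 (arXiv:1108.1335v2 TeX L3405–3421, L3449–3450)] -/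
theorem mem_blockTrees {v : α} {Q : Finset α} {t : α → α} :
    t ∈ blockTrees H v Q ↔ ∃ r ∈ Q, H v r ∧ t ∈ treeGraphs H Q r := by
  simp only [blockTrees, Finset.mem_biUnion, Finset.mem_filter, and_assoc]

/-! ## §3 Gluing block trees at the root -/

/-- GLUE: given a family `ρ` of blocks partitioning `V ∖ {v}` and a tree `F Q` on each block `Q`, rooted at a vertex `r_Q`, attach
every `r_Q` to `v`: the parent of `u ∈ Q` is its parent in `F Q`, except that the root `r_Q` (the fixed vertex of `F Q`) gets
parent `v`; points outside `V ∖ {v}` are fixed. [cite: Dimock2013, App. B Theorem cluster, proof step 4 (arXiv:1108.1335v2 TeX L3405–3421, L3449–3450)] -/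
def glue (V : Finset α) (v : α) (ρ : Finset (Finset α)) (F : Finset α → α → α) : α → α :=
  fun u => if u ∈ V.erase v then (if F (blockOf ρ u) u = u then v else F (blockOf ρ u) u) else u

section Glue

variable {V : Finset α} {v : α} {ρ : Finset (Finset α)} {F : Finset α → α → α}

omit [Fintype α] in
/-- points outside `V ∖ {v}` are fixed by the glued map. [cite: Dimock2013, App. B Theorem cluster, proof step 4 (arXiv:1108.1335v2 TeX L3405–3421, L3449–3450)] -/
theorem glue_of_not_mem {u : α} (hu : u ∉ V.erase v) : glue V v ρ F u = u := by
  simp [glue, hu]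

omit [Fintype α] in
/-- the root `v` is fixed by the glued map. [cite: Dimock2013, App. B Theorem cluster, proof step 4 (arXiv:1108.1335v2 TeX L3405–3421, L3449–3450)] -/
theorem glue_root : glue V v ρ F v = v := glue_of_not_mem (by simp)

omit [Fintype α] in
/-- on a block `Q ∈ ρ` carrying a tree rooted at `r`: the glued parent map is `F Q` off the root and sends the root to `v`. [cite: Dimock2013, App. B Theorem cluster, proof step 4 (arXiv:1108.1335v2 TeX L3405–3421, L3449–3450)] -/
theorem glue_of_mem (hρ : IsSetPartition (V.erase v) ρ) {Q : Finset α} (hQ : Q ∈ ρ) {r : α}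
    (hF : IsForestOn Q {r} (F Q)) {u : α} (hu : u ∈ Q) :
    glue V v ρ F u = if u = r then v else F Q u := by
  have huV : u ∈ V.erase v := hρ.subset hQ hu
  have hb : blockOf ρ u = Q := hρ.eq_blockOf hQ hu
  simp only [glue, huV, if_true, hb]
  exact if_congr (apply_eq_self_iff hF hu) rfl rfl

omit [Fintype α] in
/-- the root of a block tree is sent to `v`. [cite: Dimock2013, App. B Theorem cluster, proof step 4 (arXiv:1108.1335v2 TeX L3405–3421, L3449–3450)] -/
theorem glue_rootOf (hρ : IsSetPartition (V.erase v) ρ) {Q : Finset α} (hQ : Q ∈ ρ) {r : α}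
    (hF : IsForestOn Q {r} (F Q)) (hr : r ∈ Q) : glue V v ρ F r = v := by
  rw [glue_of_mem hρ hQ hF hr, if_pos rfl]

omit [Fintype α] in
/-- off its root, a block is mapped by its own tree. [cite: Dimock2013, App. B Theorem cluster, proof step 4 (arXiv:1108.1335v2 TeX L3405–3421, L3449–3450)] -/
theorem glue_of_ne (hρ : IsSetPartition (V.erase v) ρ) {Q : Finset α} (hQ : Q ∈ ρ) {r : α}
    (hF : IsForestOn Q {r} (F Q)) {u : α} (hu : u ∈ Q) (hur : u ≠ r) : glue V v ρ F u = F Q u := by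
  rw [glue_of_mem hρ hQ hF hu, if_neg hur]

omit [Fintype α] in
/-- the glued walk from `u ∈ Q` follows the block tree to its root `r` … [cite: Dimock2013, App. B Theorem cluster, proof step 4 (arXiv:1108.1335v2 TeX L3405–3421, L3449–3450)] -/
theorem glue_iterate_hit (hρ : IsSetPartition (V.erase v) ρ) {Q : Finset α} (hQ : Q ∈ ρ) {r : α}
    (hF : IsForestOn Q {r} (F Q)) (hr : r ∈ Q) {u : α} (hu : u ∈ Q) :
    ∃ n, (glue V v ρ F)^[n] u = r ∧ (glue V v ρ F)^[n + 1] u = v := by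
  obtain ⟨n, hn, hbefore⟩ := exists_first_hit hF hr hu
  have hagree : ∀ m ≤ n, (glue V v ρ F)^[m] u = (F Q)^[m] u :=
    iterate_eq_of_agree fun m hm => glue_of_ne hρ hQ hF (hbefore m hm).1 (hbefore m hm).2
  refine ⟨n, by rw [hagree n le_rfl, hn], ?_⟩
  rw [Function.iterate_succ_apply', hagree n le_rfl, hn, glue_rootOf hρ hQ hF hr]

omit [Fintype α] in
/-- … and never leaves `Q ∪ {v}`. [cite: Dimock2013, App. B Theorem cluster, proof step 4 (arXiv:1108.1335v2 TeX L3405–3421, L3449–3450)] -/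
theorem glue_iterate_mem (hρ : IsSetPartition (V.erase v) ρ) {Q : Finset α} (hQ : Q ∈ ρ) {r : α}
    (hF : IsForestOn Q {r} (F Q)) (hr : r ∈ Q) {u : α} (hu : u ∈ Q) (m : ℕ) :
    (glue V v ρ F)^[m] u ∈ Q ∨ (glue V v ρ F)^[m] u = v := by
  induction m with
  | zero => exact Or.inl (by simpa using hu)
  | succ m ih =>
    rw [Function.iterate_succ_apply']
    rcases ih with h | h
    · by_cases hwr : (glue V v ρ F)^[m] u = r
      · exact Or.inr (by rw [hwr, glue_rootOf hρ hQ hF hr])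
      · left
        rw [glue_of_ne hρ hQ hF h hwr]
        exact hF.apply_mem (Finset.singleton_subset_iff.2 hr) h
    · exact Or.inr (by rw [h, glue_root])

omit [Fintype α] in
/-- the glued map is a tree on `V` rooted at `v`, contained in `H` when the block trees are and their roots are adjacent to `v`. [cite: Dimock2013, App. B Theorem cluster, proof step 4 (arXiv:1108.1335v2 TeX L3405–3421, L3449–3450)] -/
theorem glue_mem_treeGraphs [Fintype α] (hsymm : ∀ a b, H a b → H b a) (hρ : IsSetPartition (V.erase v) ρ)
    (hF : ∀ Q ∈ ρ, ∃ r ∈ Q, H v r ∧ F Q ∈ treeGraphs H Q r) : glue V v ρ F ∈ treeGraphs H V v := by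
  refine mem_treeGraphs.2 ⟨⟨fun u hu => glue_of_not_mem (by rwa [Finset.sdiff_singleton_eq_erase] at hu), fun u hu => ?_⟩,
    fun u hu => ?_⟩
  · by_cases huv : u = v
    · exact ⟨0, by simp [huv]⟩
    · have hu' : u ∈ V.erase v := Finset.mem_erase.2 ⟨huv, hu⟩
      obtain ⟨r, hr, -, hFQ⟩ := hF _ (hρ.blockOf_mem hu')
      obtain ⟨n, -, hn⟩ := glue_iterate_hit hρ (hρ.blockOf_mem hu') (mem_treeGraphs.1 hFQ).1 hr (hρ.mem_blockOf hu')
      exact ⟨n + 1, by rw [hn]; exact Finset.mem_singleton_self _⟩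
  · obtain ⟨r, hr, hvr, hFQ⟩ := hF _ (hρ.blockOf_mem hu)
    obtain ⟨hforest, hadj⟩ := mem_treeGraphs.1 hFQ
    by_cases hur : u = r
    · rw [hur, glue_rootOf hρ (hρ.blockOf_mem hu) hforest hr]
      exact hsymm _ _ hvr
    · rw [glue_of_ne hρ (hρ.blockOf_mem hu) hforest (hρ.mem_blockOf hu) hur]
      exact hadj u (Finset.mem_erase.2 ⟨hur, hρ.mem_blockOf hu⟩)

end Glue

/-! ## §4 The glued tree determines the blocks and the block trees (injectivity) -/

section Injective

variable {V : Finset α} {v : α}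

omit [Fintype α] in
/-- every block of one gluing datum is contained in a block of any other datum with the same glued tree. [cite: Dimock2013, App. B Theorem cluster, proof step 4 (arXiv:1108.1335v2 TeX L3405–3421, L3449–3450)] -/
theorem block_subset_of_glue_eq [Fintype α] {ρ ρ' : Finset (Finset α)} {F F' : Finset α → α → α}
    (hρ : IsSetPartition (V.erase v) ρ) (hρ' : IsSetPartition (V.erase v) ρ')
    (hF : ∀ Q ∈ ρ, ∃ r ∈ Q, H v r ∧ F Q ∈ treeGraphs H Q r)
    (hF' : ∀ Q ∈ ρ', ∃ r ∈ Q, H v r ∧ F' Q ∈ treeGraphs H Q r)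
    (heq : glue V v ρ F = glue V v ρ' F') {Q : Finset α} (hQ : Q ∈ ρ) : ∃ P' ∈ ρ', Q ⊆ P' := by
  obtain ⟨r, hr, -, hFQ⟩ := hF Q hQ
  have hrV : r ∈ V.erase v := hρ.subset hQ hr
  refine ⟨blockOf ρ' r, hρ'.blockOf_mem hrV, fun w hw => ?_⟩
  have hwV : w ∈ V.erase v := hρ.subset hQ hw
  -- the glued walk from `w` reaches `r` (datum 1) and stays in `blockOf ρ' w ∪ {v}` (datum 2)
  obtain ⟨n, hn, -⟩ := glue_iterate_hit hρ hQ (mem_treeGraphs.1 hFQ).1 hr hw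
  obtain ⟨r', hr', -, hFQ'⟩ := hF' _ (hρ'.blockOf_mem hwV)
  have hmem := glue_iterate_mem hρ' (hρ'.blockOf_mem hwV) (mem_treeGraphs.1 hFQ').1 hr' (hρ'.mem_blockOf hwV) n
  rw [← heq, hn] at hmem
  rcases hmem with h | h
  · -- `r ∈ blockOf ρ' w`, so the blocks of `w` and `r` in `ρ'` coincide
    rw [hρ'.eq_of_mem (hρ'.blockOf_mem hrV) (hρ'.blockOf_mem hwV) (hρ'.mem_blockOf hrV) h]
    exact hρ'.mem_blockOf hwV
  · exact absurd h (Finset.mem_erase.1 hrV).1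

omit [Fintype α] in
/-- the glued tree determines the blocks. [cite: Dimock2013, App. B Theorem cluster, proof step 4 (arXiv:1108.1335v2 TeX L3405–3421, L3449–3450)] -/
theorem eq_of_glue_eq [Fintype α] {ρ ρ' : Finset (Finset α)} {F F' : Finset α → α → α}
    (hρ : IsSetPartition (V.erase v) ρ) (hρ' : IsSetPartition (V.erase v) ρ')
    (hF : ∀ Q ∈ ρ, ∃ r ∈ Q, H v r ∧ F Q ∈ treeGraphs H Q r)
    (hF' : ∀ Q ∈ ρ', ∃ r ∈ Q, H v r ∧ F' Q ∈ treeGraphs H Q r)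
    (heq : glue V v ρ F = glue V v ρ' F') : ρ = ρ' := by
  have key : ∀ {ρ ρ' : Finset (Finset α)} {F F' : Finset α → α → α}, IsSetPartition (V.erase v) ρ →
      IsSetPartition (V.erase v) ρ' → (∀ Q ∈ ρ, ∃ r ∈ Q, H v r ∧ F Q ∈ treeGraphs H Q r) →
      (∀ Q ∈ ρ', ∃ r ∈ Q, H v r ∧ F' Q ∈ treeGraphs H Q r) → glue V v ρ F = glue V v ρ' F' → ρ ⊆ ρ' := by
    intro ρ ρ' F F' hρ hρ' hF hF' heq Q hQ
    obtain ⟨P', hP', hQP'⟩ := block_subset_of_glue_eq hρ hρ' hF hF' heq hQ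
    obtain ⟨P, hP, hP'P⟩ := block_subset_of_glue_eq hρ' hρ hF' hF heq.symm hP'
    obtain ⟨w, hw⟩ := hρ.nonempty_of_mem hQ
    have hQP : Q = P := hρ.eq_of_mem hQ hP hw (hP'P (hQP' hw))
    subst hQP
    rwa [Finset.Subset.antisymm hQP' hP'P]
  exact Finset.Subset.antisymm (key hρ hρ' hF hF' heq) (key hρ' hρ hF' hF heq.symm)

omit [Fintype α] in
/-- the glued tree determines each block tree. [cite: Dimock2013, App. B Theorem cluster, proof step 4 (arXiv:1108.1335v2 TeX L3405–3421, L3449–3450)] -/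
theorem apply_eq_of_glue_eq [Fintype α] {ρ : Finset (Finset α)} {F F' : Finset α → α → α}
    (hρ : IsSetPartition (V.erase v) ρ)
    (hF : ∀ Q ∈ ρ, ∃ r ∈ Q, H v r ∧ F Q ∈ treeGraphs H Q r)
    (hF' : ∀ Q ∈ ρ, ∃ r ∈ Q, H v r ∧ F' Q ∈ treeGraphs H Q r)
    (heq : glue V v ρ F = glue V v ρ F') {Q : Finset α} (hQ : Q ∈ ρ) : F Q = F' Q := by
  obtain ⟨r, hr, -, hFQ⟩ := hF Q hQ
  obtain ⟨r', hr', -, hFQ'⟩ := hF' Q hQ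
  have hT := (mem_treeGraphs.1 hFQ).1
  have hT' := (mem_treeGraphs.1 hFQ').1
  have hvQ : v ∉ Q := fun h => (Finset.mem_erase.1 (hρ.subset hQ h)).1 rfl
  -- the two roots coincide: the root is the vertex of `Q` sent to `v`
  have hrr : r = r' := by
    by_contra hne
    have h1 : glue V v ρ F r = v := glue_rootOf hρ hQ hT hr
    rw [heq, glue_of_ne hρ hQ hT' hr hne] at h1
    exact hvQ (h1 ▸ hT'.apply_mem (Finset.singleton_subset_iff.2 hr') hr)
  subst hrr
  funext u
  by_cases hu : u ∈ Q
  · by_cases hur : u = r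
    · rw [hur, hT.apply_of_mem_roots (Finset.mem_singleton_self _), hT'.apply_of_mem_roots (Finset.mem_singleton_self _)]
    · rw [← glue_of_ne hρ hQ hT hu hur, ← glue_of_ne hρ hQ hT' hu hur, heq]
  · rw [hT.apply_of_not_mem hu, hT'.apply_of_not_mem hu]

end Injective

/-! ## §5 The tree-graph inequality -/

section Bound

variable (H)

/-- the gluing data of the rooted recursion at `v`: a set partition `ρ` of `V ∖ {v}` and, on each block, a tree rooted at a vertex
adjacent to `v`. [cite: Dimock2013, App. B Theorem cluster, proof step 4 (arXiv:1108.1335v2 TeX L3405–3421, L3449–3450)] -/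
def recData (V : Finset α) (v : α) : Finset (Σ ρ : Finset (Finset α), (Q : Finset α) → Q ∈ ρ → (α → α)) :=
  (setPartitions (V.erase v)).sigma fun ρ => ρ.pi fun Q => blockTrees H v Q

/-- extension of a dependent family of block trees to all finite sets (identity off `ρ`). [cite: Dimock2013, App. B Theorem cluster, proof step 4 (arXiv:1108.1335v2 TeX L3405–3421, L3449–3450)] -/
def extend (ρ : Finset (Finset α)) (f : (Q : Finset α) → Q ∈ ρ → (α → α)) : Finset α → α → α :=
  fun Q => if h : Q ∈ ρ then f Q h else id

/-- the gluing map on the data. [cite: Dimock2013, App. B Theorem cluster, proof step 4 (arXiv:1108.1335v2 TeX L3405–3421, L3449–3450)] -/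
def glueData (V : Finset α) (v : α) (x : Σ ρ : Finset (Finset α), (Q : Finset α) → Q ∈ ρ → (α → α)) : α → α :=
  glue V v x.1 (extend x.1 x.2)

variable {H}

/-- the size of the gluing data: `Σ_ρ Π_{Q∈ρ} #blockTrees(Q)`. [cite: Dimock2013, App. B Theorem cluster, proof step 4 (arXiv:1108.1335v2 TeX L3405–3421, L3449–3450)] -/
theorem card_recData (V : Finset α) (v : α) :
    ((recData H V v).card : ℤ) = ∑ ρ ∈ setPartitions (V.erase v), ∏ Q ∈ ρ, ((blockTrees H v Q).card : ℤ) := by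
  rw [recData, Finset.card_sigma]
  push_cast
  exact Finset.sum_congr rfl fun ρ _ => by rw [Finset.card_pi]; push_cast; rfl

/-- the extended family consists of block trees rooted at neighbours of `v`. [cite: Dimock2013, App. B Theorem cluster, proof step 4 (arXiv:1108.1335v2 TeX L3405–3421, L3449–3450)] -/
theorem extend_spec {ρ : Finset (Finset α)} {f : (Q : Finset α) → Q ∈ ρ → (α → α)} {v : α}
    (hf : f ∈ ρ.pi fun Q => blockTrees H v Q) :
    ∀ Q ∈ ρ, ∃ r ∈ Q, H v r ∧ extend ρ f Q ∈ treeGraphs H Q r := by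
  intro Q hQ
  have := Finset.mem_pi.1 hf Q hQ
  rw [mem_blockTrees] at this
  simpa [extend, hQ] using this

/-- gluing maps the data into the tree graphs on `V` rooted at `v`. [cite: Dimock2013, App. B Theorem cluster, proof step 4 (arXiv:1108.1335v2 TeX L3405–3421, L3449–3450)] -/
theorem glueData_mem (hsymm : ∀ a b, H a b → H b a) {V : Finset α} {v : α} {x} (hx : x ∈ recData H V v) :
    glueData V v x ∈ treeGraphs H V v := by
  obtain ⟨ρ, f⟩ := x
  obtain ⟨hρ, hf⟩ := Finset.mem_sigma.1 hx
  exact glue_mem_treeGraphs hsymm (mem_setPartitions.1 hρ) (extend_spec hf)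

/-- gluing is injective on the data. [cite: Dimock2013, App. B Theorem cluster, proof step 4 (arXiv:1108.1335v2 TeX L3405–3421, L3449–3450)] -/
theorem glueData_injOn (V : Finset α) (v : α) : Set.InjOn (glueData (α := α) V v) (recData H V v) := by
  rintro ⟨ρ, f⟩ hx ⟨ρ', f'⟩ hy heq
  obtain ⟨hρ, hf⟩ := Finset.mem_sigma.1 (Finset.mem_coe.1 hx)
  obtain ⟨hρ', hf'⟩ := Finset.mem_sigma.1 (Finset.mem_coe.1 hy)
  have hρp := mem_setPartitions.1 hρ
  have hρp' := mem_setPartitions.1 hρ'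
  obtain rfl : ρ = ρ' := eq_of_glue_eq hρp hρp' (extend_spec hf) (extend_spec hf') heq
  have hF : ∀ Q ∈ ρ, extend ρ f Q = extend ρ f' Q := fun Q hQ =>
    apply_eq_of_glue_eq hρp (extend_spec hf) (extend_spec hf') heq hQ
  have : f = f' := by
    funext Q hQ
    simpa [extend, hQ] using hF Q hQ
  subst this
  rfl

/-- **THE TREE-GRAPH INEQUALITY** (*"one can show that |ρ^T(Y_1,…,Y_n)| ≤ number of tree graphs contained in g"*): for a
symmetric graph `H` and a finite vertex set `V ∋ v`, the hard-core Ursell coefficient is bounded by the number of spanning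
trees of `H` on `V` (as parent maps towards `v`). [cite: Dimock2013, App. B Theorem cluster, proof step 4 (arXiv:1108.1335v2 TeX L3405–3421, L3449–3450)] -/
theorem abs_hcUrsell_le_card_treeGraphs (hsymm : ∀ a b, H a b → H b a) :
    ∀ (V : Finset α) {v : α}, v ∈ V → |hcUrsell H V| ≤ (treeGraphs H V v).card := by
  intro V
  induction V using Finset.strongInduction with
  | H V ih =>
    intro v hv
    rw [hcUrsell_eq_hcRootedUrsell hsymm hv, hcRootedUrsell]
    -- per-block bound from the induction hypothesis
    have hblock : ∀ ρ ∈ setPartitions (V.erase v), ∀ Q ∈ ρ,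
        |adjInd H v Q * hcUrsell H Q| ≤ ((blockTrees H v Q).card : ℤ) := by
      intro ρ hρ Q hQ
      have hQV : Q ⊂ V := Finset.ssubset_of_subset_of_ssubset ((mem_setPartitions.1 hρ).subset hQ) (Finset.erase_ssubset hv)
      unfold adjInd
      by_cases h : ∃ u ∈ Q, H v u
      · obtain ⟨r, hr, hvr⟩ := h
        rw [if_pos ⟨r, hr, hvr⟩, one_mul]
        refine (ih Q hQV hr).trans ?_
        exact_mod_cast Finset.card_le_card (Finset.subset_biUnion_of_mem (fun r => treeGraphs H Q r) (Finset.mem_filter.2 ⟨hr, hvr⟩))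
      · rw [if_neg h, zero_mul, abs_zero]
        positivity
    calc |∑ ρ ∈ setPartitions (V.erase v), (-1) ^ ρ.card * ∏ Q ∈ ρ, (adjInd H v Q * hcUrsell H Q)|
        ≤ ∑ ρ ∈ setPartitions (V.erase v), |(-1 : ℤ) ^ ρ.card * ∏ Q ∈ ρ, (adjInd H v Q * hcUrsell H Q)| :=
          Finset.abs_sum_le_sum_abs _ _
      _ = ∑ ρ ∈ setPartitions (V.erase v), ∏ Q ∈ ρ, |adjInd H v Q * hcUrsell H Q| := by
          refine Finset.sum_congr rfl fun ρ _ => ?_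
          rw [abs_mul, abs_pow, abs_neg, abs_one, one_pow, one_mul, Finset.abs_prod]
      _ ≤ ∑ ρ ∈ setPartitions (V.erase v), ∏ Q ∈ ρ, ((blockTrees H v Q).card : ℤ) :=
          Finset.sum_le_sum fun ρ hρ => Finset.prod_le_prod (fun Q _ => abs_nonneg _) fun Q hQ => hblock ρ hρ Q hQ
      _ = (recData H V v).card := (card_recData V v).symm
      _ ≤ (treeGraphs H V v).card := by
          exact_mod_cast Finset.card_le_card_of_injOn (glueData V v) (fun x hx => glueData_mem hsymm hx) (glueData_injOn V v)

/-- the number of tree graphs on `V` is at most Cayley's number `|V|^{|V|−2}` of all trees on `V`. [cite: Dimock2013, App. B Theorem cluster, proof step 4 (arXiv:1108.1335v2 TeX L3405–3421, L3449–3450)] -/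
theorem card_treeGraphs_le_pow (V : Finset α) {v : α} (hv : v ∈ V) : (treeGraphs H V v).card ≤ V.card ^ (V.card - 2) := by
  refine (Finset.card_le_card (treeGraphs_subset_forests V v)).trans (le_of_eq ?_)
  have h := card_forests_mul_card V {v} (Finset.singleton_subset_iff.2 hv)
  rw [Finset.card_singleton, one_mul] at h
  have hn : 1 ≤ V.card := Finset.card_pos.2 ⟨v, hv⟩
  rcases Nat.lt_or_ge V.card 2 with h2 | h2
  · have h1 : V.card = 1 := by omega
    rw [h1] at h
    simpa [h1] using h
  · have hpow : V.card ^ (V.card - 1) = V.card ^ (V.card - 2) * V.card := by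
      rw [← pow_succ]; congr 1; omega
    rw [hpow] at h
    exact Nat.eq_of_mul_eq_mul_right (by omega) h

/-- **COROLLARY (the classical tree bound)**: `|ρ^T| ≤ |V|^{|V|−2}`. [cite: Dimock2013, App. B Theorem cluster, proof step 4 (arXiv:1108.1335v2 TeX L3405–3421, L3449–3450)] -/
theorem abs_hcUrsell_le_pow (hsymm : ∀ a b, H a b → H b a) (V : Finset α) (hV : V.Nonempty) :
    |hcUrsell H V| ≤ (V.card : ℤ) ^ (V.card - 2) := by
  obtain ⟨v, hv⟩ := hV
  refine (abs_hcUrsell_le_card_treeGraphs hsymm V hv).trans ?_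
  exact_mod_cast card_treeGraphs_le_pow V hv

end Bound

/-! ## §6 No tree graph crosses a split: `ρ^T = 0` "if the `Y_j` can be divided into disjoint sets" -/

section Split

variable {V : Finset α} {v : α}

/-- if `V` splits into two parts with no `H`-edge between them, both meeting `V`, there is no tree graph on `V` inside `H`. [cite: Dimock2013, App. B Theorem cluster, proof step 4 (arXiv:1108.1335v2 TeX L3405–3421, L3449–3450)] -/
theorem treeGraphs_eq_empty_of_split {A : Finset α} (hA : (V ∩ A).Nonempty) (hB : (V \ A).Nonempty)
    (hsplit : ∀ a ∈ V, a ∈ A → ∀ b ∈ V, b ∉ A → ¬ H a b ∧ ¬ H b a) (hv : v ∈ V) : treeGraphs H V v = ∅ := by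
  classical
  refine Finset.eq_empty_of_forall_notMem fun t ht => ?_
  obtain ⟨hT, hadj⟩ := mem_treeGraphs.1 ht
  -- the part `S` of `V` not containing `v`, as a predicate
  let inS : α → Prop := fun u => u ∈ V ∧ (u ∈ A ↔ v ∉ A)
  -- a vertex `u` in the part opposite to `v`
  obtain ⟨u, huS⟩ : ∃ u, inS u := by
    by_cases hvA : v ∈ A
    · obtain ⟨b, hb⟩ := hB
      exact ⟨b, (Finset.mem_sdiff.1 hb).1, by simp [hvA, (Finset.mem_sdiff.1 hb).2]⟩
    · obtain ⟨a, ha⟩ := hA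
      exact ⟨a, (Finset.mem_inter.1 ha).1, by simp [hvA, (Finset.mem_inter.1 ha).2]⟩
  have hvS : ¬ inS v := fun h => by simpa using h.2
  -- the walk from `u` reaches `v`, hence leaves the part of `u`; look at the first exit
  obtain ⟨n, hn⟩ := hT.2 u huS.1
  rw [Finset.mem_singleton] at hn
  have hex : ∃ m, ¬ inS (t^[m] u) := ⟨n, by rw [hn]; exact hvS⟩
  let m := Nat.find hex
  have hm : ¬ inS (t^[m] u) := Nat.find_spec hex
  have hm0 : m ≠ 0 := fun h => by
    have : ¬ inS (t^[m] u) := hm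
    rw [h] at this
    exact this (by simpa using huS)
  obtain ⟨k, hk⟩ := Nat.exists_eq_succ_of_ne_zero hm0
  have hwS : inS (t^[k] u) := by
    have := Nat.find_min hex (show k < m from hk ▸ Nat.lt_succ_self k)
    simpa using this
  set w := t^[k] u with hw
  have htw : ¬ inS (t w) := by
    have : t^[m] u = t w := by rw [hk, Function.iterate_succ_apply']
    rw [← this]; exact hm
  have hwV : w ∈ V := hwS.1
  have hwv : w ≠ v := fun h => hvS (h ▸ hwS)
  have htwV : t w ∈ V := hT.apply_mem (Finset.singleton_subset_iff.2 hv) hwV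
  have hH : H w (t w) := hadj w (Finset.mem_erase.2 ⟨hwv, hwV⟩)
  -- `w` and `t w` lie on opposite sides
  by_cases hwA : w ∈ A
  · have hvA : v ∉ A := hwS.2.1 hwA
    have htwA : t w ∉ A := fun h => htw ⟨htwV, by simp [h, hvA]⟩
    exact (hsplit w hwV hwA (t w) htwV htwA).1 hH
  · have hvA : v ∈ A := by
      by_contra h; exact hwA (hwS.2.2 h)
    have htwA : t w ∈ A := by
      by_contra h; exact htw ⟨htwV, by simp [h, hvA]⟩
    exact (hsplit (t w) htwV htwA w hwV hwA).2 hH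

end Split

/-! ## §7 Dimock's form: the indices of a tuple `(Y_1, …, Y_n)`, the overlap graph `g`, `ρ^T`, (sunset), the bound -/

section Dimock

variable {ι : Type*} [DecidableEq ι] {C : Type*} [DecidableEq C]

/-- the OVERLAP GRAPH `g` on the indices: *"a pair {i,j} ∈ g if Y_i ∩ Y_j ≠ ∅"* (L3416–3418); equivalently `ζ(Y_i,Y_j) − 1 ≠ 0`. [cite: Dimock2013, App. B Theorem cluster, proof step 3 (arXiv:1108.1335v2 TeX L3316–3354)] -/
def overlapGraph (Y : ι → Finset C) : ι → ι → Prop := fun i j => ¬ Disjoint (Y i) (Y j)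

/-- the overlap graph is decidable. [cite: Dimock2013, App. B Theorem cluster, proof step 3 (arXiv:1108.1335v2 TeX L3316–3354)] -/
instance (Y : ι → Finset C) : DecidableRel (overlapGraph Y) := fun i j => by unfold overlapGraph; infer_instance

omit [DecidableEq ι] [DecidableEq C] in
/-- the overlap graph is symmetric. [cite: Dimock2013, App. B Theorem cluster, proof step 3 (arXiv:1108.1335v2 TeX L3316–3354)] -/
theorem overlapGraph_symm (Y : ι → Finset C) : ∀ i j, overlapGraph Y i j → overlapGraph Y j i :=
  fun _ _ h h' => h h'.symm

/-- **`ρ^T(Y_1, …, Y_n)`** — *"ρ^T(Y) = 1 and for n ≥ 2 ρ^T(Y_1,…,Y_n) = Σ_G Π_{{i,j}∈G}(ζ(Y_i,Y_j) − 1) where the sum is now over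
connected graphs G on (1,…,n)"* (L3347–3352) — here AS THE UNIQUE SOLUTION OF (sunset) (L3341–3346), i.e. the tree's Möbius-defined
hard-core Ursell coefficient of the index set for the overlap graph (`…LatticeModels.hcUrsell`; reading (ii)). [cite: Dimock2013, App. B Theorem cluster, proof step 3 (arXiv:1108.1335v2 TeX L3316–3354)] -/
def rhoT (Y : ι → Finset C) (I : Finset ι) : ℤ := hcUrsell (overlapGraph Y) I

/-- **(sunset)** (L3341–3346): *"Π_{{i,j}} ζ(Y_i,Y_j) = Σ_K Σ_{{I_1,…,I_K} ∈ π_{n,K}} Π_k ρ^T(Y_{I_k})"* — the product of the hard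
cores (`= 1` iff the `Y_i`, `i ∈ I`, are pairwise disjoint, else `0`) is the sum over the set partitions of the index set of the
products of the `ρ^T` of the blocks. [cite: Dimock2013, App. B Theorem cluster, proof step 3 (arXiv:1108.1335v2 TeX L3316–3354)] -/
theorem sunset (Y : ι → Finset C) (I : Finset ι) :
    ∑ π ∈ setPartitions I, ∏ P ∈ π, rhoT Y P =
      if ∀ i ∈ I, ∀ j ∈ I, i ≠ j → Disjoint (Y i) (Y j) then 1 else 0 := by
  unfold rhoT
  rw [sum_setPartitions_prod_hcUrsell, edgeFreeInd]
  refine if_congr ?_ rfl rfl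
  simp only [IsCompatible, Set.Pairwise, Finset.mem_coe, overlapGraph, not_not, ne_eq]

/-- `ρ^T` of a single index is `1` (*"We have defined ρ^T(Y) = 1"*, L3347). [cite: Dimock2013, App. B Theorem cluster, proof step 3 (arXiv:1108.1335v2 TeX L3316–3354)] -/
theorem rhoT_singleton (Y : ι → Finset C) (i : ι) : rhoT Y {i} = 1 := by
  have h := sunset Y {i}
  rw [Literature.Probability.LatticeModels.setPartitions_singleton, Finset.sum_singleton, Finset.prod_singleton] at h
  rw [h, if_pos]
  intro a ha b hb hab
  rw [Finset.mem_singleton] at ha hb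
  exact absurd (ha.trans hb.symm) hab

/-- **THE TREE-GRAPH INEQUALITY, AS PRINTED** (L3418–3421: *"The expression ρ^T(Y_1,…,Y_n) only depends on the graph (it is a
certain sum over subgraphs) and one can show that |ρ^T(Y_1,…,Y_n)| ≤ number of tree graphs contained in g"*), the tree graphs
recorded as parent maps towards any fixed index `i` (L3449: *"a tree graph τ can be thought of as a map τ from (1,…,n) to itself"*). [cite: Dimock2013, App. B Theorem cluster, proof step 4 (arXiv:1108.1335v2 TeX L3405–3421, L3449–3450)] -/
theorem abs_rhoT_le_card_treeGraphs [Fintype ι] (Y : ι → Finset C) {I : Finset ι} {i : ι} (hi : i ∈ I) :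
    |rhoT Y I| ≤ (treeGraphs (overlapGraph Y) I i).card :=
  abs_hcUrsell_le_card_treeGraphs (overlapGraph_symm Y) I hi

/-- … hence at most Cayley's number `n^{n−2}` of all tree graphs on `n` indices. [cite: Dimock2013, App. B Theorem cluster, proof step 4 (arXiv:1108.1335v2 TeX L3405–3421, L3449–3450)] -/
theorem abs_rhoT_le_pow [Fintype ι] (Y : ι → Finset C) {I : Finset ι} (hI : I.Nonempty) :
    |rhoT Y I| ≤ (I.card : ℤ) ^ (I.card - 2) :=
  abs_hcUrsell_le_pow (overlapGraph_symm Y) I hI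

/-- *"We do have ρ^T(Y_1,…,Y_n) = 0 if the Y_j can be divided into disjoint sets"* (L3353–3354): if the indices split into two
nonempty groups with no overlap across, no tree graph on the indices lies in `g`, so `ρ^T = 0` by the tree-graph inequality. [cite: Dimock2013, App. B Theorem cluster, proof step 3 (arXiv:1108.1335v2 TeX L3316–3354)] -/
theorem rhoT_eq_zero_of_split [Fintype ι] (Y : ι → Finset C) {I J : Finset ι} (hJ : (I ∩ J).Nonempty) (hJ' : (I \ J).Nonempty)
    (hsplit : ∀ a ∈ I, a ∈ J → ∀ b ∈ I, b ∉ J → Disjoint (Y a) (Y b)) : rhoT Y I = 0 := by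
  obtain ⟨i, hi⟩ := hJ
  have h := abs_rhoT_le_card_treeGraphs Y (Finset.mem_inter.1 hi).1 (i := i)
  have hempty : treeGraphs (overlapGraph Y) I i = ∅ :=
    treeGraphs_eq_empty_of_split (H := overlapGraph Y) ⟨i, hi⟩ hJ' (fun a ha haJ b hb hbJ =>
      ⟨not_not.2 (hsplit a ha haJ b hb hbJ), not_not.2 (hsplit a ha haJ b hb hbJ).symm⟩) (Finset.mem_inter.1 hi).1
  rw [hempty, Finset.card_empty, Nat.cast_zero] at h
  exact abs_nonpos_iff.1 h

/-! ## §8 (v1.1) Reading (ii) discharged: `ρ^T`, the solution of (sunset), IS the printed connected-graph sum -/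

open Literature.MathematicalPhysics.QuantumFieldTheory.Dimock2011to13.MayerExpansion (IsConnColl)
open Literature.MathematicalPhysics.QuantumFieldTheory.Dimock2011to13.UrsellConnectedGraphSum (connSum pairs zetaSubOne
  Adj hcUrsell_eq_connSum hcUrsell_eq_sum_graphs)

/-- `ρ^T(Y_I)` equals the sum over the connected spanning edge sets `G ⊆ g|_I` of `(−1)^{|G|}` (the printed sum with the
vanishing terms — graphs not inside the overlap graph `g` — removed: `ζ − 1 ∈ {0, −1}`), for nonempty `I`; the sibling
leaf's `hcUrsell_eq_connSum` for the overlap graph. [cite: Dimock2013, App. B Theorem cluster, proof step 3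
(arXiv:1108.1335v2 TeX L3316–3354)] -/
theorem rhoT_eq_connSum (Y : ι → Finset C) {I : Finset ι} (hI : I.Nonempty) :
    rhoT Y I = connSum (overlapGraph Y) I :=
  hcUrsell_eq_connSum (overlapGraph_symm Y) I hI

open Classical in
/-- **`ρ^T` AS PRINTED** (L3347–3352: *"We have defined ρ^T(Y) = 1 and for n ≥ 2 ρ^T(Y_1,…,Y_n) = Σ_G Π_{{i,j}∈G}
(ζ(Y_i,Y_j) − 1) where the sum is now over connected graphs G on (1,…,n)"*): for nonempty `I`, the solution `rhoT Y I` of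
(sunset) equals the sum over ALL connected graphs `G` on the index set `I` (finite sets of unordered pairs of distinct
indices, `UrsellConnectedGraphSum.pairs`, with `(I, G)` connected) of `Π_{e∈G} (ζ_e − 1)`, `ζ − 1 = zetaSubOne` taking the
value `−1` on the edges of `g` and `0` elsewhere — reading (ii) of v1 is now a theorem (the sibling leaf's
`hcUrsell_eq_sum_graphs`). [cite: Dimock2013, App. B Theorem cluster, proof step 3 (arXiv:1108.1335v2 TeX L3316–3354)] -/
theorem rhoT_eq_sum_graphs (Y : ι → Finset C) {I : Finset ι} (hI : I.Nonempty) :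
    rhoT Y I = ∑ G ∈ (pairs I).powerset with IsConnColl (Adj G) I, ∏ e ∈ G, zetaSubOne (overlapGraph Y) I e :=
  hcUrsell_eq_sum_graphs (overlapGraph_symm Y) hI

/-! ## §9 (v1.2) Step 4's Cayley input (spit2): `Σ_τ Π_j (d_j − 1)! ≤ (n−2)! 4^{n−1}` over the tree graphs in `g` -/

open Literature.Combinatorics.Enumerative.CayleyDegreeFormula (degree sum_trees_prod_factorial_le)

omit [DecidableEq ι] [DecidableEq C] in
/-- **(spit2) OVER THE TREE GRAPHS OF ANY GRAPH**: for a graph `H` on a finite vertex type, a vertex set `V` with `|V| ≥ 2`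
and `v ∈ V`, `Σ_{τ ∈ treeGraphs H V v} Π_{u∈V} (d_u(τ) − 1)! ≤ (|V| − 2)! · 4^{|V| − 1}`, where `d_u(τ)` is the incidence
number of `u` in the tree `τ` (recorded as a parent map towards `v`: number of children plus one for the parent edge,
`CayleyDegreeFormula.degree`) — by monotonicity from the sum over ALL trees on `V`, which the tree's Cayley formula with
prescribed degrees ([Rivasseau1991] Thm I.4.1, `CayleyDegreeFormula.sum_trees_prod_factorial_le`) evaluates as
`(n−2)!·#{realised degree vectors} ≤ (n−2)!·4^{n−1}` (Dimock: *"By Cayley's theorem the number of trees with incidence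
numbers d_j is (n−2)!/Π_{j=1}^n (d_j−1)! so we have Σ_τ Π_{j=1}^n (d_j−1)! = Σ_{d_1,…,d_n}(Π_{j=1}^n (d_j−1)!)Σ_{τ with d_j} 1
≤ Σ_{d_1,…,d_n}(n−2)! ≤ (n−2)! 4^{n−1}"*). [cite: Dimock2013, App. B Theorem cluster, proof step 4 eq. (spit2)
(arXiv:1108.1335v2 TeX L3487–3500)] -/
theorem sum_treeGraphs_prod_factorial_le (V : Finset α) {v : α} (hv : v ∈ V) (h2 : 2 ≤ V.card) :
    ∑ τ ∈ treeGraphs H V v, ∏ u ∈ V, (degree V v τ u - 1).factorial ≤ (V.card - 2).factorial * 4 ^ (V.card - 1) :=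
  (Finset.sum_le_sum_of_subset_of_nonneg (treeGraphs_subset_forests V v) fun _ _ _ => Nat.zero_le _).trans
    (sum_trees_prod_factorial_le hv h2)

/-- **DIMOCK'S (spit2)** for an indivisible tuple `(Y_i)_{i∈I}`, `|I| = n ≥ 2`: summed over the tree graphs `τ` contained in
the overlap graph `g` (parent maps towards a fixed index `i`), `Σ_τ Π_{j∈I} (d_j − 1)! ≤ (n−2)! 4^{n−1}`. [cite: Dimock2013,
App. B Theorem cluster, proof step 4 eq. (spit2) (arXiv:1108.1335v2 TeX L3487–3500)] -/
theorem sum_treeGraphs_overlap_prod_factorial_le [Fintype ι] (Y : ι → Finset C) {I : Finset ι} {i : ι} (hi : i ∈ I)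
    (h2 : 2 ≤ I.card) :
    ∑ τ ∈ treeGraphs (overlapGraph Y) I i, ∏ j ∈ I, (degree I i τ j - 1).factorial ≤
      (I.card - 2).factorial * 4 ^ (I.card - 1) :=
  sum_treeGraphs_prod_factorial_le I hi h2

end Dimock

end TreeGraphs

end Literature.MathematicalPhysics.QuantumFieldTheory.Dimock2011to13.UrsellTreeGraphBound

end
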